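import Summits.ResolutionOfSingularities.ResolutionOfSingularities.Theorems.HilbertSamuelEliminationSigmaMaxModificationsCorridor3WLadderIsoTailsFreeRationalArcLimitTower
import Summits.ResolutionOfSingularities.ResolutionOfSingularities.Theorems.HilbertSamuelEliminationSigmaMaxModificationsCorridor3WLadderIsoTailsFormalFrameAssemblyStepIdeal
import Summits.ResolutionOfSingularities.ResolutionOfSingularities.Theorems.HilbertSamuelEliminationSigmaMaxModificationsCorridor3WLadderIsoTailsBennettArcHyp
import Summits.ResolutionOfSingularities.ResolutionOfSingularities.Theorems.HilbertSamuelEliminationSigmaMaxModificationsCorridor3WLadderIsoTailsFormalFrameBase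
import Summits.ResolutionOfSingularities.ResolutionOfSingularities.Theorems.HilbertSamuelEliminationSigmaMaxModificationsCorridor3WLadderIsoTailsTowerDrop
import Literature.AlgebraicGeometry.Resolution.RegularSystemOfParameters
import Mathlib.RingTheory.RegularLocalRing.Polynomial
import Mathlib.AlgebraicGeometry.Morphisms.FiniteType
import HarnessLib

/-!
# [OURS · L1 W4.2] D14 ROUTE G v2 «ARC LIMIT» — object G2f, part 3: **THE FINAL ASSEMBLY — K1 `IsoFreeRationalTailsImpossible p 3`
# IN EVERY EMBEDDING DIMENSION, UNCONDITIONAL** (`isoFreeRationalTailsImpossible_holds`)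
# (crux `SigmaMaxModifications` stmt-ResolutionOfSingularities-18506 / conjunct stmt-…-19249; closes res-L1-w42-lead-1 g5's v8.4 stub
# `stub_isoK1 : ∀ p, p.Prime → IdeasL1C5.IsoFreeRationalTailsImpossible p 3` BY NAME; res-L1-w42-lead-1 `ROUTE-G-ARCLIMIT.md` §4 G2f;
# res-L1-w42-plan-1 RULING v3.14-20 (FO))

Prover res-L1-w42-stub-2 (gen 5), G2f FINAL ASSEMBLY (taken 2026-08-27T15:13:46Z, left by res-type-001). Helper file
`--supports stmt-ResolutionOfSingularities-19249 --as helper`; kernel only, no definitions, no named fact. OURS (cell res-hironaka, slot W4.2);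
NOT statements of [Hironaka2017] nor of [CossartJannsenSaito2020] / [CossartPiltant2009]. AI-written; AI review is weaker than expert review.

## The assembly

Given an isolated point tower `(T, pt)` at level `3` over a maximal origin of characteristic `p` ALL of whose steps are rational and
non-satellite (the stage-`0` form of K1, `isoFreeRationalTailsImpossible_of_forall_zero`):

1. `exists_regular_presentation_stalk_with_coefficientField` — a presentation `σ₀ : R₀ ↠ 𝒪_{X_0,x_0}` with `R₀` regular local containing
   a coefficient field (a localised polynomial ring over the ground field `k` of the maximal origin, with the image of `k`);
2. `exists_free_index_of_eq` — for any regular system of parameters `c` of `R₀`, SOME `c_j` carries the first step ((FREE)₀: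
   res-type-071's `EmbeddedStep.exists_stalk_presentation_ideal`, clause «`σ′((c_k/c_j)/1)·π♯σ(c_j) = π♯σ(c_k)`»); swap `j ↔ 0`;
3. res-type-038's base frame `exists_baseFrame_of_rsop` (`ψ₀ : R₀ → κ⟦X_0, …, X_d⟧`, `κ = κ(R̂₀)`, `ψ₀ (x i) = X i`);
4. THE ℕ-ITERATION of res-type-071's frame link `FormalFrameGen.exists_frameStep_ideal` (p542215) — stage invariant = its clauses at
   stage `n` ((FREE)ₙ at `x 0`, local frame with `ψ (x 0) = X 0`, slopes, residue-onto), link = `(ι, c₁)` with the frame commutation,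
   the kernel link `(ker σ).map ι ≤ ker σ′` and the `x′ 0`-SATURATION of `ker σ′` (recursion by choice, as res-D-pv-010's
   `exists_arc_of_frameTower_of_baseFrame`);
5. part 2 (`IsoTailsHS.exists_bennettArc_of_frameTower`) on the stages `≥ 1` (where the kernels are `t`-saturated), nearness from
   res-type-001's H1 `hilbertSamuelFun_stalk_eq_of_isIsoPointTower` ⟹ the sheared formal equations `J` of stage `1`, `S ⧸ J ≃ 𝒪̂_{X_1,x_1}`,
   and Bennett's equality along the arc prime `P₀`;
6. res-type-001's H∞-FINAL-G `false_of_isIsoPointTower_of_stage_of_bennettArc` (p533299) at `n₀ := 1` with `P := P₀`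
   (`ArcLimit.isRegularLocalRing_quotient_arcIdeal`, `ArcLimit.ringKrullDim_quotient_arcIdeal`, lead-1 p540598) ⟹ `False`.

* `false_of_isIsoPointTower_of_forall_freeRational` — steps 1–6;
* **`isoFreeRationalTailsImpossible_holds (p) : IsoFreeRationalTailsImpossible p 3`** (no primality needed) and the stub-shaped
  `forall_prime_isoFreeRationalTailsImpossible : ∀ p, p.Prime → IsoFreeRationalTailsImpossible p 3` (= `stub_isoK1`).

[OURS · L1 W4.2; AI-written] [cite: CossartPiltant2009, ch. 3 I.9] [cite: HerrmannIkedaOrbanz1988, Thm. (22.24)] [cite: CossartJannsenSaito2020, Def. 6.34, Def. 6.38]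
-/

set_option linter.dupNamespace false

noncomputable section

open CategoryTheory AlgebraicGeometry TopologicalSpace IsLocalRing MvPowerSeries
open Literature.AlgebraicGeometry.Resolution Literature.RingTheory.HilbertSamuel
open Literature.AlgebraicGeometry.CossartJannsenSaito2020
open Summit.ResolutionOfSingularities.ResolutionOfSingularities.Theorems.CampaignW42
open Summit.ResolutionOfSingularities.ResolutionOfSingularities.Theorems.SigmaMaxModificationsCorridor3
open Summit.ResolutionOfSingularities.ResolutionOfSingularities.Cruxes.SigmaMaxModifications
open Summit.ResolutionOfSingularities.ResolutionOfSingularities.Cruxes.SigmaMaxModifications.IdeasL1C4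
open Summit.ResolutionOfSingularities.ResolutionOfSingularities.Cruxes.SigmaMaxModifications.IdeasL1Idea2R4
open Summit.ResolutionOfSingularities.ResolutionOfSingularities.Cruxes.SigmaMaxModifications.IdeasL1C5

namespace Summit.ResolutionOfSingularities.ResolutionOfSingularities.Theorems.SigmaMaxModificationsCorridor3.IsoTailsHS

universe u

/-! ## §1. A presentation of characteristic `p`, and the free index -/

/-- **The local rings of a scheme locally of finite type over a field are quotients of regular local rings CONTAINING A COEFFICIENT FIELD**
(localisations of polynomial rings at primes, with the image of the ground field; compare `TameWild.exists_regular_presentation_stalk`) — the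
input of res-type-038's base frame `exists_baseFrame_of_rsop`. [folklore] -/
theorem exists_regular_presentation_stalk_with_coefficientField {k : Type u} [Field k] {Y : Scheme.{u}}
    (g : Y ⟶ Spec (.of k)) [LocallyOfFiniteType g] (y : Y) :
    ∃ (R : Type u) (_ : CommRing R) (_ : IsRegularLocalRing R) (k₀ : Subring R) (_ : IsField k₀) (σ : R →+* Y.presheaf.stalk y),
      Function.Surjective σ := by
  classical
  obtain ⟨U, hU, hyU, -⟩ :=
    exists_isAffineOpen_mem_and_subset (X := Y) (x := y) (U := ⊤) (Opens.mem_top y)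
  -- `Γ(Y, U)` is a `k`-algebra of finite type
  let φ₀ : k →+* Γ(Y, U) := (g.appLE ⊤ U le_top).hom.comp (Scheme.ΓSpecIso (.of k)).inv.hom
  have hφ₀ : φ₀.FiniteType := by
    have h1 : (g.appLE ⊤ U le_top).hom.FiniteType :=
      HasRingHomProperty.appLE @LocallyOfFiniteType g inferInstance ⟨⊤, isAffineOpen_top _⟩ ⟨U, hU⟩ le_top
    exact h1.comp (RingHom.FiniteType.of_surjective _
      (Scheme.ΓSpecIso (.of k)).symm.commRingCatIsoToRingEquiv.surjective)
  letI : Algebra k Γ(Y, U) := φ₀.toAlgebra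
  haveI : Algebra.FiniteType k Γ(Y, U) := hφ₀
  obtain ⟨n, ψ, hψ⟩ := Algebra.FiniteType.iff_quotient_mvPolynomial''.mp ‹Algebra.FiniteType k Γ(Y, U)›
  -- the stalk is the localisation of `Γ(Y, U)` at the prime of `y`
  letI : Algebra Γ(Y, U) (Y.presheaf.stalk y) := TopCat.Presheaf.algebra_section_stalk Y.presheaf ⟨y, hyU⟩
  let q : Ideal Γ(Y, U) := (hU.primeIdealOf ⟨y, hyU⟩).asIdeal
  haveI : IsLocalization.AtPrime (Y.presheaf.stalk y) q := hU.isLocalization_stalk ⟨y, hyU⟩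
  -- pull back to the polynomial ring
  let Q : Ideal (MvPolynomial (Fin n) k) := q.comap ψ.toRingHom
  haveI : Q.IsPrime := Ideal.comap_isPrime _ _
  have hle : Q.primeCompl ≤ q.primeCompl.comap ψ.toRingHom := fun t ht => ht
  let f : Localization.AtPrime Q →+* Y.presheaf.stalk y := IsLocalization.map (Y.presheaf.stalk y) ψ.toRingHom hle
  -- the coefficient field: the (isomorphic) image of `k` in `k[X]_Q`
  let φ : k →+* Localization.AtPrime Q := (algebraMap (MvPolynomial (Fin n) k) (Localization.AtPrime Q)).comp MvPolynomial.C
  have hφ : Function.Bijective φ.rangeRestrict := ⟨fun a b h => φ.injective (congrArg Subtype.val h), φ.rangeRestrict_surjective⟩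
  have hk₀ : IsField φ.range := (RingEquiv.ofBijective _ hφ).symm.toMulEquiv.isField (Field.toIsField k)
  refine ⟨Localization.AtPrime Q, inferInstance, inferInstance, φ.range, hk₀, f, ?_⟩
  intro z
  obtain ⟨⟨b, s⟩, rfl⟩ := IsLocalization.mk'_surjective q.primeCompl z
  obtain ⟨a, ha⟩ := hψ b
  obtain ⟨t, ht⟩ := hψ s
  have htQ : t ∈ Q.primeCompl := by
    show t ∉ Q
    intro htQ'
    have : (s : Γ(Y, U)) ∈ q := by rw [← ht]; exact htQ'
    exact s.2 this
  refine ⟨IsLocalization.mk' _ a ⟨t, htQ⟩, ?_⟩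
  rw [IsLocalization.map_mk']
  congr 1
  all_goals first | exact ha | exact Subtype.ext ht

/-- **(FREE)₀ at SOME index**: for a blow-up `π : X′ → X` with `D_x = 𝔪_x`, `x′ ↦ x`, and ANY presentation `σ : R ↠ 𝒪_{X,x}` with a regular
system of parameters `c`, some `π♯σ(c_j)` divides every `π♯σ(c_k)` in `𝒪_{X′,x′}` (res-type-071's `EmbeddedStep.exists_stalk_presentation_ideal`:
the chart `j` containing `x′`), stated with the base point named (`π x′ = x` as an equation, `stalkCongr`). [cite: GortzWedhorn2020, Prop. 13.91]
[cite: StacksProject, Tag 0804] -/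
theorem exists_free_index_of_eq {X X' : Scheme.{u}} {π : X' ⟶ X} {D : X.IdealSheafData} (hπ : IsBlowup π D) (x' : X') (x : X)
    (hx : π.base x' = x) (hD : stalkIdeal D x = maximalIdeal (X.presheaf.stalk x))
    {R : Type u} [CommRing R] [IsRegularLocalRing R] {d : ℕ} (hd : (maximalIdeal R).spanFinrank = d)
    (c : Fin d → R) (hc : Ideal.span (Set.range c) = maximalIdeal R) (σ : R →+* X.presheaf.stalk x)
    (hσ : Function.Surjective σ) :
    ∃ j : Fin d, ∀ k, (π.stalkMap x').hom ((X.presheaf.stalkCongr (.of_eq hx)).inv (σ (c j))) ∣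
      (π.stalkMap x').hom ((X.presheaf.stalkCongr (.of_eq hx)).inv (σ (c k))) := by
  subst hx
  have hid : ∀ a : X.presheaf.stalk (π.base x'),
      (X.presheaf.stalkCongr (.of_eq (rfl : π.base x' = π.base x'))).inv a = a := fun a => by
    rw [TopCat.Presheaf.stalkCongr_inv]
    exact stalkSpecializes_self_apply _ _ _ a
  simp only [hid]
  obtain ⟨j, 𝔔, σ', -, -, -, -, -, -, -, -, h9, -, -⟩ := EmbeddedStep.exists_stalk_presentation_ideal hπ x' hD hd c hc σ hσ
  exact ⟨j, fun k => ⟨_, by rw [mul_comm]; exact (h9 k).symm⟩⟩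

/-! ## §2. The assembly -/

set_option maxHeartbeats 3200000 in
-- the stage invariant is a long conjunction over stalks (as in res-D-pv-010's `exists_arc_of_frameTower_of_baseFrame`)
/-- **K1 FROM STAGE `0`, EVERY EMBEDDING DIMENSION.** An isolated point tower at level `3` over a maximal origin of characteristic `p`
cannot have ALL its steps rational and non-satellite — steps 1–6 of the module docstring. [OURS · L1 W4.2; AI-written]
[cite: CossartPiltant2009, ch. 3 I.9] [cite: HerrmannIkedaOrbanz1988, Thm. (22.24)] -/
theorem false_of_isIsoPointTower_of_forall_freeRational {p : ℕ} {ν : ℕ → ℕ} {T : BlowupTower.{u}} {pt : ∀ n, T.X n}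
    (hO : IsMaximalOrigin p 3 ν (T.X 0) (pt 0)) (hT : IsIsoPointTower 3 ν T pt)
    (hrat : ∀ n, IsRationalStep T pt n) (hnsat : ∀ n, ¬ IsSatelliteStep T pt n) : False := by
  classical
  haveI : ∀ n, IsLocallyNoetherian (T.X n) := T.ln
  have hC : ∀ n, T.C n = {pt n} := hT.1
  have hpt : ∀ n, (T.π n).base (pt (n + 1)) = pt n := hT.2.1
  have hcl : ∀ n, IsClosed ({pt n} : Set (T.X n)) := hT.2.2.1
  -- (1) a presentation with a coefficient field at stage `0`
  obtain ⟨k, _, _, g, -, hft, -⟩ := hO.exists_structure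
  haveI := hft
  obtain ⟨R₀, _, _, k₀, hk₀, σ₀, hσ₀⟩ := exists_regular_presentation_stalk_with_coefficientField g (pt 0)
  -- (2) a regular system of parameters with (FREE)₀ at index `0`
  obtain ⟨c₀, hc₀⟩ := exists_regularSystemOfParameters (R := R₀)
  obtain ⟨j, hj⟩ := exists_free_index_of_eq (T.isBlowup 0) (pt 1) (pt 0) (hpt 0)
    (EmbeddedStep.stalkIdeal_centreIdeal_eq_maximalIdeal T pt 0 (hC 0) (hcl 0)) rfl c₀ hc₀ σ₀ hσ₀
  -- the embedding dimension is positive: write it as `d + 1`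
  obtain ⟨d, hd⟩ : ∃ d, (maximalIdeal R₀).spanFinrank = d + 1 :=
    ⟨(maximalIdeal R₀).spanFinrank - 1, (Nat.succ_pred_eq_of_pos (Fin.pos j)).symm⟩
  let c : Fin (d + 1) → R₀ := c₀ ∘ finCongr hd.symm
  have hc : Ideal.span (Set.range c) = maximalIdeal R₀ := by
    rw [(finCongr hd.symm).surjective.range_comp]; exact hc₀
  let j' : Fin (d + 1) := finCongr hd j
  have hj' : ∀ i, ((T.π 0).stalkMap (pt (0 + 1))).hom (((T.X 0).presheaf.stalkCongr (.of_eq (hpt 0))).inv (σ₀ (c j'))) ∣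
      ((T.π 0).stalkMap (pt (0 + 1))).hom (((T.X 0).presheaf.stalkCongr (.of_eq (hpt 0))).inv (σ₀ (c i))) := fun i => by
    have h := hj (finCongr hd.symm i)
    simpa [c, j'] using h
  let x : Fin (d + 1) → R₀ := c ∘ Equiv.swap 0 j'
  have hx : Ideal.span (Set.range x) = maximalIdeal R₀ := by
    rw [(Equiv.swap (0 : Fin (d + 1)) j').surjective.range_comp]; exact hc
  have hfree : ∀ i, ((T.π 0).stalkMap (pt (0 + 1))).hom (((T.X 0).presheaf.stalkCongr (.of_eq (hpt 0))).inv (σ₀ (x 0))) ∣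
      ((T.π 0).stalkMap (pt (0 + 1))).hom (((T.X 0).presheaf.stalkCongr (.of_eq (hpt 0))).inv (σ₀ (x i))) := fun i => by
    show ((T.π 0).stalkMap (pt (0 + 1))).hom (((T.X 0).presheaf.stalkCongr (.of_eq (hpt 0))).inv (σ₀ (c (Equiv.swap 0 j' 0)))) ∣
      ((T.π 0).stalkMap (pt (0 + 1))).hom (((T.X 0).presheaf.stalkCongr (.of_eq (hpt 0))).inv (σ₀ (c (Equiv.swap 0 j' i))))
    rw [Equiv.swap_apply_left]
    exact hj' _
  -- (3) the base frame
  obtain ⟨_, -, ψ₀, -, -, -, -, hloc₀, hψx, hres₀⟩ := FormalFrame.exists_baseFrame_of_rsop R₀ k₀ hk₀ hd x hx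
  haveI := hloc₀
  set κ := ResidueField (AdicCompletion (maximalIdeal R₀) R₀) with hκ
  -- (4) THE ITERATION. Stage invariant:
  obtain ⟨P, hP⟩ : ∃ P : ∀ (n : ℕ) (S : Type u) [CommRing S] [IsRegularLocalRing S], (Fin (d + 1) → S) →
      (S →+* (T.X n).presheaf.stalk (pt n)) → (S →+* MvPowerSeries (Fin (d + 1)) κ) → (Fin (d + 1) → κ) → Prop,
      P = fun (n : ℕ) (S : Type u) [CommRing S] [IsRegularLocalRing S] (y : Fin (d + 1) → S)
          (τ : S →+* (T.X n).presheaf.stalk (pt n)) (φ : S →+* MvPowerSeries (Fin (d + 1)) κ) (l : Fin (d + 1) → κ) =>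
        (maximalIdeal S).spanFinrank = d + 1 ∧ Ideal.span (Set.range y) = maximalIdeal S ∧ Function.Surjective τ ∧
        (∀ i, ((T.π n).stalkMap (pt (n + 1))).hom (((T.X n).presheaf.stalkCongr (.of_eq (hpt n))).inv (τ (y 0))) ∣
          ((T.π n).stalkMap (pt (n + 1))).hom (((T.X n).presheaf.stalkCongr (.of_eq (hpt n))).inv (τ (y i)))) ∧
        IsLocalHom φ ∧ φ (y 0) = X 0 ∧
        (∀ i, i ≠ 0 → φ (y i) - X i - C (l i) * X 0 ∈ maximalIdeal (MvPowerSeries (Fin (d + 1)) κ) ^ 2) ∧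
        (∀ a : κ, ∃ r : S, φ r - C a ∈ maximalIdeal (MvPowerSeries (Fin (d + 1)) κ)) := ⟨_, rfl⟩
  -- the link between consecutive stages: the frame commutation, the kernel link, the saturation of the new kernel
  obtain ⟨L, hL⟩ : ∃ L : ∀ (n : ℕ) (S : Type u) [CommRing S] (S' : Type u) [CommRing S'],
      (S →+* (T.X n).presheaf.stalk (pt n)) → (S' →+* (T.X (n + 1)).presheaf.stalk (pt (n + 1))) →
      (S →+* MvPowerSeries (Fin (d + 1)) κ) → (S' →+* MvPowerSeries (Fin (d + 1)) κ) → (Fin (d + 1) → S') → Prop,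
      L = fun (n : ℕ) (S : Type u) [CommRing S] (S' : Type u) [CommRing S'] (τ : S →+* (T.X n).presheaf.stalk (pt n))
          (τ' : S' →+* (T.X (n + 1)).presheaf.stalk (pt (n + 1)))
          (φ : S →+* MvPowerSeries (Fin (d + 1)) κ) (φ' : S' →+* MvPowerSeries (Fin (d + 1)) κ) (y' : Fin (d + 1) → S') =>
        ∃ (ι : S →+* S') (c₁ : Fin (d + 1) → κ), (∀ r, φ' (ι r) = subst (SeriesGen.transChartSubst c₁) (φ r)) ∧
          (RingHom.ker τ).map ι ≤ RingHom.ker τ' ∧ (∀ r, y' 0 * r ∈ RingHom.ker τ' → r ∈ RingHom.ker τ') := ⟨_, rfl⟩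
  -- the state space
  obtain ⟨St, hSt⟩ : ∃ St : ℕ → Type (u + 1), St = fun n =>
      Σ' (S : Type u) (i : CommRing S) (j : IsRegularLocalRing S) (y : Fin (d + 1) → S) (τ : S →+* (T.X n).presheaf.stalk (pt n))
        (φ : S →+* MvPowerSeries (Fin (d + 1)) κ) (l : Fin (d + 1) → κ), @P n S i j y τ φ l := ⟨_, rfl⟩
  subst hSt
  -- the step (res-type-071's frame link)
  have hstep : ∀ n (s : (fun n => Σ' (S : Type u) (i : CommRing S) (j : IsRegularLocalRing S) (y : Fin (d + 1) → S)
      (τ : S →+* (T.X n).presheaf.stalk (pt n)) (φ : S →+* MvPowerSeries (Fin (d + 1)) κ) (l : Fin (d + 1) → κ),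
      @P n S i j y τ φ l) n),
      ∃ s' : (fun n => Σ' (S : Type u) (i : CommRing S) (j : IsRegularLocalRing S) (y : Fin (d + 1) → S)
        (τ : S →+* (T.X n).presheaf.stalk (pt n)) (φ : S →+* MvPowerSeries (Fin (d + 1)) κ) (l : Fin (d + 1) → κ),
        @P n S i j y τ φ l) (n + 1),
        @L n s.1 s.2.1 s'.1 s'.2.1 s.2.2.2.2.1 s'.2.2.2.2.1 s.2.2.2.2.2.1 s'.2.2.2.2.2.1 s'.2.2.2.1 := by
    intro n s
    obtain ⟨S, i, j, y, τ, φ, l, hPn⟩ := s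
    rw [hP] at hPn
    obtain ⟨h1, h2, h3, h4, h5, h6, h7, h8⟩ := hPn
    haveI := h5
    obtain ⟨R', i', j', x', σ', ψ', lam', ι, c₁, hr⟩ :=
      FormalFrameGen.exists_frameStep_ideal T pt n (hC n) (hcl n) (hpt n) (hpt (n + 1)) (hrat n) (hnsat n) h1 y h2 τ h3 h4 φ h6 l
        h7 h8
    have hP' : @P (n + 1) R' i' j' x' σ' ψ' lam' := by
      rw [hP]
      exact ⟨hr.1, hr.2.1, hr.2.2.1, hr.2.2.2.2.2.2.2.2.1, hr.2.2.2.2.2.2.2.2.2.1, hr.2.2.2.2.2.2.2.2.2.2.1, hr.2.2.2.2.2.2.2.2.2.2.2.1,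
        hr.2.2.2.2.2.2.2.2.2.2.2.2.1⟩
    have hL' : @L n S i R' i' τ σ' φ ψ' x' := by
      rw [hL]
      exact ⟨ι, c₁, hr.2.2.2.2.2.2.2.2.2.2.2.2.2, hr.2.2.2.1, hr.2.2.2.2.1⟩
    exact ⟨⟨R', i', j', x', σ', ψ', lam', hP'⟩, hL'⟩
  -- the base stage
  have hP0 : @P 0 R₀ _ _ x σ₀ ψ₀ (fun _ => 0) := by
    rw [hP]
    refine ⟨hd, hx, hσ₀, hfree, hloc₀, hψx 0, fun i _ => ?_, hres₀⟩
    rw [hψx i, map_zero, zero_mul, sub_self, sub_zero]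
    exact Ideal.zero_mem _
  -- the recursion (choice)
  obtain ⟨st, hst0, hst⟩ : ∃ st : ∀ n, (fun n => Σ' (S : Type u) (i : CommRing S) (j : IsRegularLocalRing S) (y : Fin (d + 1) → S)
      (τ : S →+* (T.X n).presheaf.stalk (pt n)) (φ : S →+* MvPowerSeries (Fin (d + 1)) κ) (l : Fin (d + 1) → κ),
      @P n S i j y τ φ l) n,
      st 0 = ⟨R₀, inferInstance, inferInstance, x, σ₀, ψ₀, fun _ => 0, hP0⟩ ∧
        ∀ n, st (n + 1) = Classical.choose (hstep n (st n)) :=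
    ⟨fun n => Nat.rec (motive := fun n => (fun n => Σ' (S : Type u) (i : CommRing S) (j : IsRegularLocalRing S)
        (y : Fin (d + 1) → S) (τ : S →+* (T.X n).presheaf.stalk (pt n)) (φ : S →+* MvPowerSeries (Fin (d + 1)) κ)
        (l : Fin (d + 1) → κ), @P n S i j y τ φ l) n)
      ⟨R₀, inferInstance, inferInstance, x, σ₀, ψ₀, fun _ => 0, hP0⟩ (fun n s => Classical.choose (hstep n s)) n,
      rfl, fun n => rfl⟩
  letI : ∀ n, CommRing (st n).1 := fun n => (st n).2.1
  letI : ∀ n, IsRegularLocalRing (st n).1 := fun n => (st n).2.2.1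
  have hlink : ∀ n, ∃ (ι : (st n).1 →+* (st (n + 1)).1) (c₁ : Fin (d + 1) → κ),
      (∀ r, (st (n + 1)).2.2.2.2.2.1 (ι r) = subst (SeriesGen.transChartSubst c₁) ((st n).2.2.2.2.2.1 r)) ∧
        (RingHom.ker (st n).2.2.2.2.1).map ι ≤ RingHom.ker (st (n + 1)).2.2.2.2.1 ∧
        (∀ r, (st (n + 1)).2.2.2.1 0 * r ∈ RingHom.ker (st (n + 1)).2.2.2.2.1 → r ∈ RingHom.ker (st (n + 1)).2.2.2.2.1) := by
    intro n
    have hs := Classical.choose_spec (hstep n (st n))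
    rw [← hst n, hL] at hs
    exact hs
  choose ι c₁ hcomm hker hsat using hlink
  -- read off the stage clauses (generalised over the state, so that `P` can be unfolded)
  have hPt : ∀ (n : ℕ) (S : Type u) [CommRing S] [IsRegularLocalRing S] (y : Fin (d + 1) → S)
      (τ : S →+* (T.X n).presheaf.stalk (pt n)) (φ : S →+* MvPowerSeries (Fin (d + 1)) κ) (l : Fin (d + 1) → κ),
      @P n S _ _ y τ φ l →
        (maximalIdeal S).spanFinrank = d + 1 ∧ Ideal.span (Set.range y) = maximalIdeal S ∧ Function.Surjective τ ∧
        IsLocalHom φ ∧ φ (y 0) = X 0 ∧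
        (∀ i, i ≠ 0 → φ (y i) - X i - C (l i) * X 0 ∈ maximalIdeal (MvPowerSeries (Fin (d + 1)) κ) ^ 2) ∧
        (∀ a : κ, ∃ r : S, φ r - C a ∈ maximalIdeal (MvPowerSeries (Fin (d + 1)) κ)) := by
    intro n S _ _ y τ φ l hq
    rw [hP] at hq
    exact ⟨hq.1, hq.2.1, hq.2.2.1, hq.2.2.2.2.1, hq.2.2.2.2.2.1, hq.2.2.2.2.2.2.1, hq.2.2.2.2.2.2.2⟩
  have hclauses : ∀ n, (maximalIdeal (st n).1).spanFinrank = d + 1 ∧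
      Ideal.span (Set.range (st n).2.2.2.1) = maximalIdeal (st n).1 ∧ Function.Surjective (st n).2.2.2.2.1 ∧
      IsLocalHom (st n).2.2.2.2.2.1 ∧ (st n).2.2.2.2.2.1 ((st n).2.2.2.1 0) = X 0 ∧
      (∀ i, i ≠ 0 → (st n).2.2.2.2.2.1 ((st n).2.2.2.1 i) - X i - C ((st n).2.2.2.2.2.2.1 i) * X 0 ∈
        maximalIdeal (MvPowerSeries (Fin (d + 1)) κ) ^ 2) ∧
      (∀ a : κ, ∃ r : (st n).1, (st n).2.2.2.2.2.1 r - C a ∈ maximalIdeal (MvPowerSeries (Fin (d + 1)) κ)) := fun n =>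
    @hPt n (st n).1 (st n).2.1 (st n).2.2.1 (st n).2.2.2.1 (st n).2.2.2.2.1 (st n).2.2.2.2.2.1 (st n).2.2.2.2.2.2.1
      (st n).2.2.2.2.2.2.2
  -- (5) part 2 on the stages `≥ 1`
  haveI : ∀ n, IsLocalHom (st (n + 1)).2.2.2.2.2.1 := fun n => (hclauses (n + 1)).2.2.2.1
  have hHS : ∀ n, hilbertFun ((T.X (n + 1)).presheaf.stalk (pt (n + 1))) = hilbertFun ((T.X (0 + 1)).presheaf.stalk (pt (0 + 1))) := by
    intro n
    have h1 := hilbertSamuelFun_stalk_eq_of_isIsoPointTower hO hT (n + 1) 0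
    have h2 := hilbertSamuelFun_stalk_eq_of_isIsoPointTower hO hT (0 + 1) 0
    simp only [hilbertSamuelFun_zero] at h1 h2
    rw [h1, h2]
  obtain ⟨J, hJloc, e', hJP', hJP, hH⟩ :=
    exists_bennettArc_of_frameTower (K := κ) (d := d) (fun n => (st (n + 1)).1) (fun n => (hclauses (n + 1)).1)
      (fun n => (st (n + 1)).2.2.2.1) (fun n => (hclauses (n + 1)).2.1)
      (fun n => (T.X (n + 1)).presheaf.stalk (pt (n + 1))) (fun n => (st (n + 1)).2.2.2.2.1) (fun n => (hclauses (n + 1)).2.2.1)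
      (fun n => hsat n) (fun n => (st (n + 1)).2.2.2.2.2.1) (fun n => (hclauses (n + 1)).2.2.2.2.1)
      (fun n => (st (n + 1)).2.2.2.2.2.2.1) (fun n => (hclauses (n + 1)).2.2.2.2.2.1) (fun n => (hclauses (n + 1)).2.2.2.2.2.2)
      (fun n => ι (n + 1)) c₁ (fun n r => hcomm (n + 1) r) (fun n => hker (n + 1)) hHS
  -- (6) res-type-001's H∞-FINAL-G at stage `1`, along `P₀`
  haveI := hJloc
  haveI := hJP'
  haveI : IsRegularLocalRing (MvPowerSeries (Fin (d + 1)) κ) := isRegularLocalRing_mvPowerSeries κ (Fin (d + 1))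
  haveI : (ArcLimit.arcIdeal d κ).IsPrime := ArcLimit.isPrime_arcIdeal
  haveI : IsRegularLocalRing (MvPowerSeries (Fin (d + 1)) κ ⧸ ArcLimit.arcIdeal d κ) := ArcLimit.isRegularLocalRing_quotient_arcIdeal
  have hP1 : ringKrullDim (MvPowerSeries (Fin (d + 1)) κ ⧸ ArcLimit.arcIdeal d κ) = (1 : ℕ) := by
    rw [ArcLimit.ringKrullDim_quotient_arcIdeal, Nat.cast_one]
  let e : ↥((T.X (0 + 1)).presheaf.stalk (pt (0 + 1))) ≃+* (st (0 + 1)).1 ⧸ RingHom.ker (st (0 + 1)).2.2.2.2.1 :=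
    (RingHom.quotientKerEquivOfSurjective (hclauses (0 + 1)).2.2.1).symm
  exact false_of_isIsoPointTower_of_stage_of_bennettArc hO hT (0 + 1) (RingHom.ker (st (0 + 1)).2.2.2.2.1) e J e'
    (ArcLimit.arcIdeal d κ) hP1 hJP hH

/-- **K1 — FREE-RATIONAL TAILS ARE IMPOSSIBLE, in EVERY embedding dimension, UNCONDITIONAL** (the D14 kernel of T3 /
`stub_WtopRecIsoM_pointed`; lead-1 g5's v8.4 stub `stub_isoK1` closes as `fun p _ => isoFreeRationalTailsImpossible_holds p`).
[OURS · L1 W4.2; AI-written] [cite: CossartPiltant2009, ch. 3 I.9] [cite: CossartJannsenSaito2020, Def. 6.38, Def. 6.39] -/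
theorem isoFreeRationalTailsImpossible_holds (p : ℕ) : IsoFreeRationalTailsImpossible.{u} p 3 :=
  isoFreeRationalTailsImpossible_of_forall_zero fun _ _ _ hO hT hall =>
    false_of_isIsoPointTower_of_forall_freeRational hO hT (fun n => (hall n).1) fun n => (hall n).2

/-- K1 in the shape of the registered stub `stub_isoK1 : ∀ p, p.Prime → IsoFreeRationalTailsImpossible p 3` (the primality is not used:
no field has a composite characteristic, and characteristic `0` is covered too). [OURS · L1 W4.2; AI-written] [cite: CossartPiltant2009, ch. 3 I.9] -/
theorem forall_prime_isoFreeRationalTailsImpossible : ∀ p : ℕ, p.Prime → IsoFreeRationalTailsImpossible.{u} p 3 :=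
  fun p _ => isoFreeRationalTailsImpossible_holds p

end Summit.ResolutionOfSingularities.ResolutionOfSingularities.Theorems.SigmaMaxModificationsCorridor3.IsoTailsHS

end
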